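import Mathlib.NumberTheory.Padics.Complex
import Literature.NumberTheory.GaloisRepresentations.GaloisRep
import HarnessLib

/-!
# `ρ̄^{ss} ≅ σ ⊕ σ'` through Frobenius characteristic polynomials (`HasResidualPair`)

Topic `Literature/NumberTheory/GaloisRepresentations` (definition item `defn-HasResidualPair`, for
route `Langlands/PhantomRM`: items PhantomRMSector, ResiduallyYoshidaLifting, StableYoshidaCongruence
inline the sub-formula this file names).

For a number field `K`, `ρ : Γ_K → GL_n(ℚ̄_p)` continuous (`FramedGaloisRep K (PadicAlgCl p) n`),
a ring map `red : 𝒪_{ℚ̄_p} = Valued.integer (PadicAlgCl p) →+* k` to a field of characteristic `p`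
(any such map kills the maximal ideal of the rank-one valuation ring, so it factors through
`𝔽̄_p`), and residual representations `σ : Γ_K → GL_a(k)`, `σ' : Γ_K → GL_b(k)`:

`ρ.HasResidualPair red σ σ'` — at all but finitely many finite places `v`, `ρ`, `σ`, `σ'` are
unramified and the Frobenius characteristic polynomial of `ρ` has coefficients in `𝒪_{ℚ̄_p}` and
reduces under `red` to the product of those of `σ` and `σ'`.

By Chebotarev and Brauer–Nesbitt this says exactly that the semisimplified reduction of (any
`Γ_K`-stable lattice in) `ρ` is `σ ⊕ σ'` up to semisimplification (Deligne–Serre 1974, §6 "réduction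
mod `λ`"; Serre 1968, Ch. I §2.3) — stated through characteristic polynomials so that no integral
model / stable lattice over the NON-noetherian `𝒪_{ℚ̄_p}` is needed (the tree's `exists_integralModel`
wants a PID). `HasResidualSemisimplification red ρ τ` is the one-piece version (`ρ̄^{ss} ≅ τ^{ss}`).

API (proved): unfolding lemmas, `HasResidualPair.symm`, `HasResidualPair.eventually_isUnramifiedAt`,
monotonicity in the cofinite filter is automatic.

Deliberately NOT here: independence of `red` up to Frobenius twist; the comparison with
`exists_integralModel` / `charpoly_residualRep` over `𝒪_E`, `E/ℚ_p` finite (`HasQlModel`); the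
block-sum `σ ⊕ σ'` as a framed representation (then `HasResidualPair ↔ HasResidualSemisimplification`
with `Matrix.charpoly_fromBlocks_zero₁₂`).

## References
* P. Deligne, J.-P. Serre, Formes modulaires de poids 1, Ann. Sci. ÉNS 7 (1974), §6. [DeligneSerre1974]
* J.-P. Serre, *Abelian ℓ-adic representations and elliptic curves* (1968), Ch. I §2.3. [SerreAbelianLadic1968]
-/

noncomputable section

open IsDedekindDomain Filter
open scoped NumberField

namespace Literature.NumberTheory.GaloisRepresentations

namespace FramedGaloisRep

variable {K : Type} [Field K] {p : ℕ} [Fact p.Prime]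
variable {k : Type*} [Field k] [TopologicalSpace k]
variable {n a b : ℕ}

/-- **`ρ̄^{ss} ≅ σ ⊕ σ'` via Frobenius characteristic polynomials.** For almost all finite places
`v` of `K`: `ρ`, `σ`, `σ'` are unramified at `v`, and there are `P ∈ 𝒪_{ℚ̄_p}[X]`, `P₁, P₂ ∈ k[X]`
with `P` the Frobenius characteristic polynomial of `ρ` at `v` (through `𝒪 ⊆ ℚ̄_p`), `P₁`, `P₂`
those of `σ`, `σ'`, and `red(P) = P₁ P₂`. (Deligne–Serre 1974 §6: reduction mod `λ` and
semisimplification are read off characteristic polynomials by Brauer–Nesbitt; Chebotarev.) [cite: DeligneSerre1974, §6 (réduction mod λ, via polynômes caractéristiques de Frobenius)]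
[cite: SerreAbelianLadic1968, Ch. I §2.3] -/
def HasResidualPair (ρ : FramedGaloisRep K (PadicAlgCl p) n)
    (red : Valued.integer (PadicAlgCl p) →+* k)
    (σ : FramedGaloisRep K k a) (σ' : FramedGaloisRep K k b) : Prop :=
  ∀ᶠ v in cofinite, ρ.IsUnramifiedAt v ∧ σ.IsUnramifiedAt v ∧ σ'.IsUnramifiedAt v ∧
    ∃ (P : Polynomial (Valued.integer (PadicAlgCl p))) (P₁ P₂ : Polynomial k),
      ρ.HasFrobCharpolyAt v (P.map (Valued.integer (PadicAlgCl p)).subtype) ∧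
      σ.HasFrobCharpolyAt v P₁ ∧ σ'.HasFrobCharpolyAt v P₂ ∧ P.map red = P₁ * P₂

/-- **`ρ̄^{ss} ≅ τ^{ss}` via Frobenius characteristic polynomials** (one-piece version): for almost
all `v`, `ρ` and `τ` are unramified at `v` and the integral Frobenius characteristic polynomial of
`ρ` reduces under `red` to that of `τ`. [cite: DeligneSerre1974, §6]
[cite: SerreAbelianLadic1968, Ch. I §2.3] -/
def HasResidualSemisimplification (ρ : FramedGaloisRep K (PadicAlgCl p) n)
    (red : Valued.integer (PadicAlgCl p) →+* k) (τ : FramedGaloisRep K k n) : Prop :=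
  ∀ᶠ v in cofinite, ρ.IsUnramifiedAt v ∧ τ.IsUnramifiedAt v ∧
    ∃ (P : Polynomial (Valued.integer (PadicAlgCl p))) (Q : Polynomial k),
      ρ.HasFrobCharpolyAt v (P.map (Valued.integer (PadicAlgCl p)).subtype) ∧
      τ.HasFrobCharpolyAt v Q ∧ P.map red = Q

variable {ρ : FramedGaloisRep K (PadicAlgCl p) n} {red : Valued.integer (PadicAlgCl p) →+* k}
  {σ : FramedGaloisRep K k a} {σ' : FramedGaloisRep K k b} {τ : FramedGaloisRep K k n}

/-- Unfolding lemma. [folklore] -/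
theorem hasResidualPair_iff :
    ρ.HasResidualPair red σ σ' ↔
      ∀ᶠ v in cofinite, ρ.IsUnramifiedAt v ∧ σ.IsUnramifiedAt v ∧ σ'.IsUnramifiedAt v ∧
        ∃ (P : Polynomial (Valued.integer (PadicAlgCl p))) (P₁ P₂ : Polynomial k),
          ρ.HasFrobCharpolyAt v (P.map (Valued.integer (PadicAlgCl p)).subtype) ∧
          σ.HasFrobCharpolyAt v P₁ ∧ σ'.HasFrobCharpolyAt v P₂ ∧ P.map red = P₁ * P₂ :=
  Iff.rfl

/-- Unfolding lemma. [folklore] -/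
theorem hasResidualSemisimplification_iff :
    ρ.HasResidualSemisimplification red τ ↔
      ∀ᶠ v in cofinite, ρ.IsUnramifiedAt v ∧ τ.IsUnramifiedAt v ∧
        ∃ (P : Polynomial (Valued.integer (PadicAlgCl p))) (Q : Polynomial k),
          ρ.HasFrobCharpolyAt v (P.map (Valued.integer (PadicAlgCl p)).subtype) ∧
          τ.HasFrobCharpolyAt v Q ∧ P.map red = Q :=
  Iff.rfl

/-- `HasResidualPair` is symmetric in the two residual pieces (`σ ⊕ σ' ≅ σ' ⊕ σ`). [folklore] -/
theorem HasResidualPair.symm (h : ρ.HasResidualPair red σ σ') : ρ.HasResidualPair red σ' σ := by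
  refine h.mono fun v hv => ?_
  obtain ⟨hρ, hσ, hσ', P, P₁, P₂, hP, hP₁, hP₂, hred⟩ := hv
  exact ⟨hρ, hσ', hσ, P, P₂, P₁, hP, hP₂, hP₁, by rw [hred, mul_comm]⟩

/-- Under `HasResidualPair`, `ρ` is unramified at almost all places (part of the definition).
[folklore] -/
theorem HasResidualPair.eventually_isUnramifiedAt (h : ρ.HasResidualPair red σ σ') :
    ∀ᶠ v in cofinite, ρ.IsUnramifiedAt v ∧ σ.IsUnramifiedAt v ∧ σ'.IsUnramifiedAt v :=
  h.mono fun _ hv => ⟨hv.1, hv.2.1, hv.2.2.1⟩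

/-- Under `HasResidualSemisimplification`, `ρ` and `τ` are unramified at almost all places.
[folklore] -/
theorem HasResidualSemisimplification.eventually_isUnramifiedAt
    (h : ρ.HasResidualSemisimplification red τ) :
    ∀ᶠ v in cofinite, ρ.IsUnramifiedAt v ∧ τ.IsUnramifiedAt v :=
  h.mono fun _ hv => ⟨hv.1, hv.2.1⟩

end FramedGaloisRep

end Literature.NumberTheory.GaloisRepresentations
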